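import Literature.NumberTheory.GaloisRepresentations.UnramifiedDatum
import HarnessLib

/-!
# `PstWeilDeligneData.nonempty`: the type of `p`-adic Hodge data is inhabited

Topic `Literature/NumberTheory/GaloisRepresentations`, sibling of `PstWeilDeligne` (the structure
`PstWeilDeligneData F ℓ` — a `ℚ_ℓ`-algebra structure on the local field `F`, a period-ring datum
`𝔅` with invariants `F`, and a relation `IsWeilDeligneOf` with Fontaine's axioms — and the named
fact `PstWeilDeligneData.nonempty`: for every `F`, `ℓ`, `[CharZero F]` and every `ℚ_ℓ`-algebra
structure on `F` there is such a datum whose `algebra` field is the given structure).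

This file DISCHARGES that named fact (`PstWeilDeligneData.nonempty_holds`).  The witness is the
accepted `unramifiedPstWeilDeligneData F ℓ` (`UnramifiedDatum`): the period ring `F̂_nr = (B_dR)^{I_F}`
(`unramifiedPeriodRingData`, with its induced trivial filtration) and the Weil–Deligne recipe
`IsWeilDeligneOf ρ r :↔ r.N = 0 ∧ r.ρ ≅ ρ|_{W_F}`, all of whose seven axioms are theorems of the
tree (admissible ⇔ unramified: Fontaine 1994, Exp. III Prop. 1.6.2, Lang's theorem; Tate,
Corvallis (4.1.3)); its `algebra` field is the ambient structure by `rfl`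
(`unramifiedPstWeilDeligneData_algebra`).

CAVEAT (recorded, not hidden).  The witness is a genuine but TRUNCATED instance of the intended
datum: relative to it "de Rham" means "unramified" and every Hodge–Tate weight is `0`
(`unramifiedPstWeilDeligneData_isDeRhamFramed_iff`, `…_unramifiedWeightsZero`).  So the named fact
AS STATED — bare inhabitedness with a prescribed `algebra` field — does not pin Fontaine's `B_dR`
and `WD ∘ D_pst`; consumers that need the genuine objects must pin the datum by further properties
(cf. the accepted refinements `CrystallineDeformationRing.nonempty`, `FontaineDatumExists`, and the
cyclotomic-weight pin used by the `∃ RD` items of the Langlands routes).  The definition items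
"construct `B_dR(K_v)`", "construct `WD ∘ D_pst`" remain the route to the intended instance.
Theorems only; no definitions, no new named facts, no `sorry`.

## References

* J.-M. Fontaine, *Représentations p-adiques semi-stables*; *Représentations ℓ-adiques
  potentiellement semi-stables*, Astérisque 223 (1994), Exp. III §1.5–1.6, Exp. VIII §1.3.
  [FontaineAsterisque223III]
* J. Tate, *Number theoretic background*, Corvallis 1979, (4.1.3), (4.1.6). [TateCorvallis1979]
-/

noncomputable section

namespace Literature.NumberTheory.GaloisRepresentations

namespace PstWeilDeligneData

/-- For every non-archimedean local field `F`, prime `ℓ` and `ℚ_ℓ`-algebra structure on `F` there is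
a `PstWeilDeligneData F ℓ` with that `algebra` field: the `F̂_nr`-datum
`unramifiedPstWeilDeligneData F ℓ` (no `CharZero` hypothesis is needed). [cite: FontaineAsterisque223III, Exp. III §1.5–1.6] -/
theorem exists_algebra_eq (F : Type) [Field F] [ValuativeRel F] [TopologicalSpace F]
    [IsNonarchimedeanLocalField F] (ℓ : ℕ) [Fact ℓ.Prime] (alg : Algebra ℚ_[ℓ] F) :
    ∃ 𝔇 : PstWeilDeligneData F ℓ, 𝔇.algebra = alg :=
  ⟨unramifiedPstWeilDeligneData F ℓ, rfl⟩

/-- In particular `PstWeilDeligneData F ℓ` is inhabited for every `ℚ_ℓ`-algebra structure on `F`.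
[cite: FontaineAsterisque223III, Exp. III §1.5–1.6] -/
theorem nonempty_of_algebra (F : Type) [Field F] [ValuativeRel F] [TopologicalSpace F]
    [IsNonarchimedeanLocalField F] (ℓ : ℕ) [Fact ℓ.Prime] [Algebra ℚ_[ℓ] F] :
    Nonempty (PstWeilDeligneData F ℓ) :=
  ⟨unramifiedPstWeilDeligneData F ℓ⟩

/-- **Discharge of the named fact `PstWeilDeligneData.nonempty`**: for every `F`, `ℓ`,
`[CharZero F]` and every `ℚ_ℓ`-algebra structure on `F`, some `𝔇 : PstWeilDeligneData F ℓ` has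
`𝔇.algebra` equal to the given structure — witnessed by the `F̂_nr`-datum (see the module
docstring for what this witness does and does not pin). [cite: FontaineAsterisque223III, Exp. III §1.5–1.6] -/
theorem nonempty_holds : PstWeilDeligneData.nonempty :=
  fun F _ _ _ _ ℓ _ _ alg => exists_algebra_eq F ℓ alg

end PstWeilDeligneData

end Literature.NumberTheory.GaloisRepresentations

end
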